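import Mathlib

/-!
# Objects for the tightness of `stub_nonnegFlatDecay` (line `unit-tensor-orbit-nuclear-ratio`,
# crux `FidelityWitnesses.DiagonalPowerDecay`, stmt-MatrixMultiplication-14053): Strassen's tensor, its degeneration
# frame, and Kronecker powers

Lead prover-line-stmt-MatrixMultiplication-14053-1.  The open stub quantifies over entrywise NON-NEGATIVE tensors
`Y : ι → ι → ι → ℂ` of spectral norm `≤ 1` ("flat") and over the open `GL³`-orbit `{(A,B,C)·I_ι}` of the unit tensor;
`NonnegFlatDecayBody c δ` is the stub at a fixed witness, unfolded VERBATIM from the registered signature.  This file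
holds the OBJECTS of the `T`-free tightness argument (proofs in `…StubNonnegFlatDecayTightness.lean`):

* predicates `Flat` (the stub's flatness hypothesis, verbatim) and `ZeroOne` (`0/1`-valued ⟹ non-negative);
* STRASSEN'S TENSOR `str = Σ_{i=1}^{3} (e₀⊗e_i⊗e_i + e_i⊗e₀⊗e_i) ∈ (ℂ⁴)^{⊗3}` (`‖str‖² = 6`, `0/1`-valued), the unit tensor
  `unitT = I₄`, the degeneration family `strT t = str + t·I₄`, and the frame `matA t = [e₀ | e₀+te₁ | e₀+te₂ | e₀+te₃]`,
  `matC t = [te₀ − (e₁+e₂+e₃)/t | e₁/t | e₂/t | e₃/t]` with explicit inverses: `strT t = (matA t, matA t, matC t)·I₄`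
  (`strT_eq_orbit`, 64 entries by `fin_cases`/`simp`), so `str` is a limit of open-orbit points (border rank `4`);
* KRONECKER POWERS on the format `Fin j → Fin 4` (`|ι| = 4^j`): `kpow T j a b c = ∏_s T (a s) (b s) (c s)` and
  `mpow M j a l = ∏_s M (a s) (l s)`, with `mpow_mul`, `mpow_one`, `isUnit_det_mpow`, `orbit_mpow` (the orbit point of a
  power frame is the power of the orbit point, `Fintype.prod_sum`), `kpow_succ`, `zeroOne_kpow`, `continuous_kpow_strT`.

Source of the gadget: V. Strassen, J. reine angew. Math. 375/376 (1987) §6 (the tensor `Σ (e₀⊗e_i⊗e_i + e_i⊗e₀⊗e_i)` of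
border rank `q+1`).  No facts are assumed; everything is finite algebra.
-/

-- the tree's namespace `Summit.MatrixMultiplication.MatrixMultiplication.…` repeats a component by design
set_option linter.dupNamespace false

noncomputable section

namespace Summit.MatrixMultiplication.MatrixMultiplication.Theorems.DiagonalPowerDecay

namespace NonnegFlatTightness

open scoped BigOperators
open Filter Topology

/-! ## The stub at fixed `(c, δ)` (verbatim body of the registered `stub_nonnegFlatDecay`) -/

/-- `stub_nonnegFlatDecay` of line `unit-tensor-orbit-nuclear-ratio` at a fixed witness `(c, δ)`: for every finite
format `ι`, every entrywise non-negative flat `Y` and every open-orbit point `S = (A,B,C)·I_ι`,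
`|⟨S,Y⟩|² ≤ c·|ι|^{3/2−δ}·‖S‖²`.  The registered stub is `∃ c δ, 0 < δ ∧ NonnegFlatDecayBody c δ`. -/
def NonnegFlatDecayBody (c δ : ℝ) : Prop :=
  ∀ (ι : Type) [Fintype ι] [DecidableEq ι] (Y : ι → ι → ι → ℂ),
    (∀ i j k, ∃ t : ℝ, 0 ≤ t ∧ Y i j k = t) →
    (∀ w u v : ι → ℂ, ‖∑ i, ∑ j, ∑ k, w i * u j * v k * Y i j k‖ ≤
      Real.sqrt (∑ i, ‖w i‖ ^ 2) * Real.sqrt (∑ j, ‖u j‖ ^ 2) * Real.sqrt (∑ k, ‖v k‖ ^ 2)) →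
    ∀ (A B C : Matrix ι ι ℂ), IsUnit A.det → IsUnit B.det → IsUnit C.det →
      ‖∑ i, ∑ j, ∑ k, (∑ l, A i l * B j l * C k l) * Y i j k‖ ^ 2 ≤
        c * (Fintype.card ι : ℝ) ^ ((3 : ℝ) / 2 - δ) *
          ∑ i, ∑ j, ∑ k, ‖∑ l, A i l * B j l * C k l‖ ^ 2

/-! ## Flatness and non-negativity, as predicates -/

/-- Spectral flatness `‖Y‖_σ ≤ 1`, unfolded as in the stub. -/
def Flat {ι : Type} [Fintype ι] (Y : ι → ι → ι → ℂ) : Prop :=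
  ∀ w u v : ι → ℂ, ‖∑ i, ∑ j, ∑ k, w i * u j * v k * Y i j k‖ ≤
    Real.sqrt (∑ i, ‖w i‖ ^ 2) * Real.sqrt (∑ j, ‖u j‖ ^ 2) * Real.sqrt (∑ k, ‖v k‖ ^ 2)

/-- `0/1`-valued tensors (a convenient sub-class of the entrywise non-negative ones, closed under products). -/
def ZeroOne {ι : Type} (Y : ι → ι → ι → ℂ) : Prop := ∀ i j k, Y i j k = 0 ∨ Y i j k = 1

/-- `0/1` tensors are entrywise non-negative (in the stub's phrasing). -/
theorem nonneg_of_zeroOne {ι : Type} {Y : ι → ι → ι → ℂ} (h : ZeroOne Y) :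
    ∀ i j k, ∃ t : ℝ, 0 ≤ t ∧ Y i j k = t := by
  intro i j k
  rcases h i j k with h0 | h1
  · exact ⟨0, le_rfl, by simp [h0]⟩
  · exact ⟨1, zero_le_one, by simp [h1]⟩

/-! ## Strassen's tensor on `Fin 4` and its degeneration frame -/

/-- Strassen's tensor `Str = Σ_{i=1}^3 (e₀⊗e_i⊗e_i + e_i⊗e₀⊗e_i)`: entry `1` at `(0,i,i)` and `(i,0,i)` for `i ≠ 0`. -/
def str (i j k : Fin 4) : ℂ :=
  if (i = 0 ∧ j = k ∧ k ≠ 0) ∨ (j = 0 ∧ i = k ∧ k ≠ 0) then 1 else 0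

/-- The unit tensor `I₄`. -/
def unitT (i j k : Fin 4) : ℂ := if i = j ∧ j = k then 1 else 0

/-- The degeneration family `Str + t·I₄` (an orbit point for `t ≠ 0`, `strT_eq_orbit`). -/
def strT (t : ℝ) (i j k : Fin 4) : ℂ := str i j k + (t : ℂ) * unitT i j k

/-- `A_t = [e₀ | e₀+te₁ | e₀+te₂ | e₀+te₃]` (columns): row `0` is all ones, row `i ≠ 0` is `t·e_i`. -/
def matA (t : ℝ) : Matrix (Fin 4) (Fin 4) ℂ :=
  fun i l => if i = 0 then 1 else if i = l then (t : ℂ) else 0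

/-- `C_t = [te₀ − (e₁+e₂+e₃)/t | e₁/t | e₂/t | e₃/t]` (columns). -/
def matC (t : ℝ) : Matrix (Fin 4) (Fin 4) ℂ :=
  fun k l => if k = 0 then (if l = 0 then (t : ℂ) else 0)
    else if l = 0 then -(t : ℂ)⁻¹ else if k = l then (t : ℂ)⁻¹ else 0

/-- Inverse of `A_t` for `t ≠ 0`. -/
def matAinv (t : ℝ) : Matrix (Fin 4) (Fin 4) ℂ :=
  fun i l => if i = 0 then (if l = 0 then 1 else -(t : ℂ)⁻¹) else if i = l then (t : ℂ)⁻¹ else 0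

/-- Inverse of `C_t` for `t ≠ 0`. -/
def matCinv (t : ℝ) : Matrix (Fin 4) (Fin 4) ℂ :=
  fun k l => if k = 0 then (if l = 0 then (t : ℂ)⁻¹ else 0)
    else if l = 0 then (t : ℂ)⁻¹ else if k = l then (t : ℂ) else 0

/-- `A_t · A_t⁻¹ = 1` (`t ≠ 0`). -/
theorem matA_mul_matAinv {t : ℝ} (ht : t ≠ 0) : matA t * matAinv t = 1 := by
  have ht' : (t : ℂ) ≠ 0 := by exact_mod_cast ht
  ext i l
  fin_cases i <;> fin_cases l <;>
    simp [Matrix.mul_apply, Fin.sum_univ_four, matA, matAinv, ht']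

/-- `C_t · C_t⁻¹ = 1` (`t ≠ 0`). -/
theorem matC_mul_matCinv {t : ℝ} (ht : t ≠ 0) : matC t * matCinv t = 1 := by
  have ht' : (t : ℂ) ≠ 0 := by exact_mod_cast ht
  ext i l
  fin_cases i <;> fin_cases l <;>
    simp [Matrix.mul_apply, Fin.sum_univ_four, matC, matCinv, ht']

/-- `Str + t·I₄ = (A_t, A_t, C_t)·I₄` entrywise (`t ≠ 0`). -/
theorem strT_eq_orbit {t : ℝ} (ht : t ≠ 0) (i j k : Fin 4) :
    strT t i j k = ∑ l, matA t i l * matA t j l * matC t k l := by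
  have ht' : (t : ℂ) ≠ 0 := by exact_mod_cast ht
  fin_cases i <;> fin_cases j <;> fin_cases k <;>
    simp [Fin.sum_univ_four, strT, str, unitT, matA, matC, ht']

/-- At `t = 0` the family is Strassen's tensor. -/
theorem strT_zero : strT 0 = str := by
  funext i j k
  simp [strT]

/-- `Str` is `0/1`-valued. -/
theorem zeroOne_str : ZeroOne str := by
  intro i j k
  unfold str
  split_ifs <;> simp

/-- `‖Str‖² = 6`. -/
theorem normSq_str : (∑ i, ∑ j, ∑ k, ‖str i j k‖ ^ 2) = 6 := by
  simp [Fin.sum_univ_four, str]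
  norm_num

/-! ## Kronecker powers on the format `Fin j → Fin 4` (`|ι| = 4^j`) -/

/-- Kronecker power of a `Fin 4`-tensor: `T^{⊠j} a b c = ∏_s T (a s) (b s) (c s)`. -/
def kpow (T : Fin 4 → Fin 4 → Fin 4 → ℂ) (j : ℕ) (a b c : Fin j → Fin 4) : ℂ :=
  ∏ s, T (a s) (b s) (c s)

/-- Kronecker power of a `4 × 4` matrix: `M^{⊗j} a l = ∏_s M (a s) (l s)`. -/
def mpow (M : Matrix (Fin 4) (Fin 4) ℂ) (j : ℕ) : Matrix (Fin j → Fin 4) (Fin j → Fin 4) ℂ :=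
  fun a l => ∏ s, M (a s) (l s)

/-- `|Fin j → Fin 4| = 4^j`. -/
theorem card_format (j : ℕ) : Fintype.card (Fin j → Fin 4) = 4 ^ j := by
  simp

/-- Kronecker powers of matrices multiply factorwise. -/
theorem mpow_mul (M M' : Matrix (Fin 4) (Fin 4) ℂ) (j : ℕ) : mpow M j * mpow M' j = mpow (M * M') j := by
  ext a l
  simp only [Matrix.mul_apply, mpow, ← Finset.prod_mul_distrib]
  rw [Fintype.prod_sum]  -- `∏ s, ∑ y, f s y = ∑ x, ∏ s, f s (x s)`

/-- The Kronecker power of the identity is the identity. -/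
theorem mpow_one (j : ℕ) : mpow (1 : Matrix (Fin 4) (Fin 4) ℂ) j = 1 := by
  ext a l
  simp only [mpow, Matrix.one_apply]
  by_cases h : a = l
  · subst h; simp
  · obtain ⟨s, hs⟩ : ∃ s, a s ≠ l s := Function.ne_iff.mp h
    rw [if_neg h]
    exact Finset.prod_eq_zero (Finset.mem_univ s) (if_neg hs)

/-- Kronecker powers of invertible matrices are invertible. -/
theorem isUnit_det_mpow {M Minv : Matrix (Fin 4) (Fin 4) ℂ} (h : M * Minv = 1) (j : ℕ) :
    IsUnit (mpow M j).det :=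
  Matrix.isUnit_det_of_right_inverse (by rw [mpow_mul, h, mpow_one])

/-- The orbit point of a Kronecker-power frame is the Kronecker power of the orbit point. -/
theorem orbit_mpow (A B C : Matrix (Fin 4) (Fin 4) ℂ) (j : ℕ) (a b c : Fin j → Fin 4) :
    (∑ L, mpow A j a L * mpow B j b L * mpow C j c L) =
      kpow (fun i i' k => ∑ l, A i l * B i' l * C k l) j a b c := by
  simp only [mpow, kpow, ← Finset.prod_mul_distrib]
  rw [Fintype.prod_sum]

/-- Peeling off the coordinate `0`: `T^{⊠(j+1)} a b c = T (a 0) (b 0) (c 0) · T^{⊠j} (tail a) (tail b) (tail c)`. -/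
theorem kpow_succ (T : Fin 4 → Fin 4 → Fin 4 → ℂ) (j : ℕ) (a b c : Fin (j + 1) → Fin 4) :
    kpow T (j + 1) a b c = T (a 0) (b 0) (c 0) * kpow T j (Fin.tail a) (Fin.tail b) (Fin.tail c) :=
  Fin.prod_univ_succ _

/-- Kronecker powers of `0/1` tensors are `0/1`. -/
theorem zeroOne_kpow {T : Fin 4 → Fin 4 → Fin 4 → ℂ} (hT : ZeroOne T) : ∀ j, ZeroOne (kpow T j) := by
  intro j
  induction j with
  | zero => intro a b c; right; simp [kpow]
  | succ j ih =>
    intro a b c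
    rw [kpow_succ]
    rcases hT (a 0) (b 0) (c 0) with h0 | h1
    · left; rw [h0, zero_mul]
    · rcases ih (Fin.tail a) (Fin.tail b) (Fin.tail c) with h0' | h1'
      · left; rw [h0', mul_zero]
      · right; rw [h1, h1', mul_one]

/-- `t ↦ (Str + t I₄)^{⊠j} a b c` is continuous. -/
theorem continuous_kpow_strT (j : ℕ) (a b c : Fin j → Fin 4) :
    Continuous fun t : ℝ => kpow (strT t) j a b c := by
  unfold kpow strT
  exact continuous_finsetProd _ fun s _ =>
    continuous_const.add (Complex.continuous_ofReal.mul continuous_const)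


end NonnegFlatTightness

/-- **Registered sub-goal `strassen_orbit_frame` (def-free): Strassen's tensor is a degeneration of the unit tensor `I₄`
with an explicit invertible frame** — for every `t ≠ 0` there are invertible `A, B, C` with
`(A,B,C)·I₄ = Str + t·I₄` entrywise (`A = B = matA t`, `C = matC t`); in particular `Str` has border rank `≤ 4`. -/
theorem strassen_orbit_frame :
    ∀ t : ℝ, t ≠ 0 → ∃ A B C : Matrix (Fin 4) (Fin 4) ℂ, IsUnit A.det ∧ IsUnit B.det ∧ IsUnit C.det ∧ ∀ i j k : Fin 4, (∑ l, A i l * B j l * C k l) = (if (i = 0 ∧ j = k ∧ k ≠ 0) ∨ (j = 0 ∧ i = k ∧ k ≠ 0) then (1 : ℂ) else 0) + (t : ℂ) * (if i = j ∧ j = k then (1 : ℂ) else 0) := by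
  intro t ht
  refine ⟨NonnegFlatTightness.matA t, NonnegFlatTightness.matA t, NonnegFlatTightness.matC t,
    Matrix.isUnit_det_of_right_inverse (NonnegFlatTightness.matA_mul_matAinv ht),
    Matrix.isUnit_det_of_right_inverse (NonnegFlatTightness.matA_mul_matAinv ht),
    Matrix.isUnit_det_of_right_inverse (NonnegFlatTightness.matC_mul_matCinv ht), fun i j k => ?_⟩
  rw [← NonnegFlatTightness.strT_eq_orbit ht i j k]
  rfl

end Summit.MatrixMultiplication.MatrixMultiplication.Theorems.DiagonalPowerDecay

end
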